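import Literature.MathematicalPhysics.QuantumLattice.StabilityLightConeProofs
import Literature.MathematicalPhysics.QuantumLattice.QuasiAdiabaticGenerator
import Literature.MathematicalPhysics.QuantumLattice.StabilitySmoothingCoreProofs
import HarnessLib

/-!
# MZ13 Lemma 1 (v), norm part: `𝓕^s(Q) − 𝓕⁰(Q)` is `O(ε)`

Top-down layer (seat B) of the formalisation of the Michalakis–Zwolak stability theorem
(hubbard.S19, `Literature.MathematicalPhysics.QuantumLattice.michalakis_zwolak`): Michalakis–Zwolak
arXiv:1109.1588 Lemma 1 (v) (p. 9: "`‖X⁽¹⁾_u(r)‖ ≤ sJ‖Q_u‖f₁⁽¹⁾(r)`"; proof p. 11), in the norm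
form needed by `michalakis_zwolak_of_tail_core`: for the smoothing maps of the path
`H_c = Σ Φ + c Σ V` (`|c| ≤ 1`) and of `H₀ = Σ Φ` with an integrable weight `w` having a
finite moment of order `d + 2`, and `Q ∈ 𝔄_{b_x(R)}`,
`‖∫ w τ_t^{H_c}(Q) dt − ∫ w τ_t^{H₀}(Q) dt‖ ≤ |c| ‖Q‖ M (‖w‖₁ + ∫ |t|^{d+2}|w|)` with `M`
depending on `d, κ, r₀, r, R` only (`exists_smoothing_diff_norm_bound`). Ingredients: the
two-Hamiltonian Duhamel bound of `QuasiAdiabaticGenerator`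
(`norm_heisenbergEvolution_sub_heisenbergEvolution_le_of_le`, reused), the commutator-with-a-sum
bound `norm_sum_commutator_le` of `LiebRobinsonProofs` (reused) and the light-cone lemma
`exists_lightCone_comm_bound`. No definitions, no named facts (theorems only).
-/

noncomputable section

open Matrix Complex MeasureTheory Finset
open scoped Matrix.Norms.L2Operator

namespace Literature.MathematicalPhysics.QuantumLattice

open Literature.Probability.LatticeModels

section Aux

variable {n : Type*} [Fintype n] [DecidableEq n]

/-- Conjugating a commutator back: `‖[τ_u(D), B]‖ = ‖[D, τ_{−u}(B)]‖` for Hermitian `H`.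
[folklore] -/
theorem norm_comm_heisenbergEvolution_eq_norm_comm_neg {H : Matrix n n ℂ} (hH : H.IsHermitian)
    (D B : Matrix n n ℂ) (u : ℝ) :
    ‖heisenbergEvolution H u D * B - B * heisenbergEvolution H u D‖ =
      ‖D * heisenbergEvolution H (-u) B - heisenbergEvolution H (-u) B * D‖ := by
  have h1 : heisenbergEvolution H (-u) (heisenbergEvolution H u D) = D := by
    rw [← heisenbergEvolution_add, neg_add_cancel, heisenbergEvolution_zero]
  have h2 : heisenbergEvolution H (-u) (heisenbergEvolution H u D * B - B * heisenbergEvolution H u D) =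
      D * heisenbergEvolution H (-u) B - heisenbergEvolution H (-u) B * D := by
    rw [heisenbergEvolution_sub, heisenbergEvolution_mul, heisenbergEvolution_mul, h1]
  rw [← h2, norm_heisenbergEvolution_holds hH]

/-- The elementary moment bound `|t| (1+|t|)^{d+1} ≤ 2^{d+2} (1 + |t|^{d+2})`. [folklore] -/
theorem abs_mul_one_add_abs_pow_le (t : ℝ) (d : ℕ) :
    |t| * (1 + |t|) ^ (d + 1) ≤ 2 ^ (d + 2) * (1 + |t| ^ (d + 2)) := by
  have ht : 0 ≤ |t| := abs_nonneg t
  have h1 : |t| * (1 + |t|) ^ (d + 1) ≤ (1 + |t|) ^ (d + 2) := by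
    rw [pow_succ (1 + |t|) (d + 1), mul_comm]
    exact mul_le_mul_of_nonneg_left (by linarith) (by positivity)
  have h2 : 1 + |t| ≤ 2 * max 1 |t| := by
    rcases le_total 1 |t| with h | h
    · rw [max_eq_right h]; linarith
    · rw [max_eq_left h]; linarith
  have h3 : (max 1 |t|) ^ (d + 2) ≤ 1 + |t| ^ (d + 2) := by
    rcases le_total 1 |t| with h | h
    · rw [max_eq_right h]; linarith
    · rw [max_eq_left h, one_pow]; have := pow_nonneg ht (d + 2); linarith
  calc |t| * (1 + |t|) ^ (d + 1) ≤ (1 + |t|) ^ (d + 2) := h1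
    _ ≤ (2 * max 1 |t|) ^ (d + 2) := pow_le_pow_left₀ (by positivity) h2 _
    _ = 2 ^ (d + 2) * (max 1 |t|) ^ (d + 2) := mul_pow _ _ _
    _ ≤ 2 ^ (d + 2) * (1 + |t| ^ (d + 2)) := mul_le_mul_of_nonneg_left h3 (by positivity)

end Aux

section Main

variable (d : ℕ) (κ : Type*) [Fintype κ] [DecidableEq κ] (q : ℕ)

/-- **MZ13 Lemma 1 (v), norm part: the smoothed term moves by `O(ε)` along the path.** For
every `r₀ r R : ℕ` there is `M ≥ 0` such that on every torus, for local `Φ` of range `r₀` with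
`‖Φ Z‖ ≤ 1`, local `V` of range `r` with `‖V Z‖ ≤ 1`, every real `|c| ≤ 1`, every integrable
weight `w` with `∫ |t|^{d+2}|w(t)| dt < ∞`, every centre `x` and every `Q ∈ 𝔄_{b_x(R)}`:
`‖∫ w(t) τ_t^{Σ Φ + c Σ V}(Q) dt − ∫ w(t) τ_t^{Σ Φ}(Q) dt‖ ≤ |c| ‖Q‖ M (‖w‖₁ + ∫ |t|^{d+2}|w|)`.
[cite: MichalakisZwolakCMP2013, §5.1 Lemma 1 (v) (arXiv:1109.1588 pp. 9–11)] -/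
theorem exists_smoothing_diff_norm_bound (r₀ r R : ℕ) :
    ∃ M : ℝ, 0 ≤ M ∧ ∀ {L : ℕ} [NeZero L] {Φ V : Interaction (TorusSite d L × κ) q}, Φ.IsLocal →
      (∀ Z, r₀ < torusDiam Z → Φ Z = 0) → (∀ Z, ‖Φ Z‖ ≤ 1) → V.IsLocal →
      (∀ Z, r < torusDiam Z → V Z = 0) → (∀ Z, ‖V Z‖ ≤ 1) → ∀ {c : ℝ}, |c| ≤ 1 →
      ∀ {w : ℝ → ℂ}, Integrable w → Integrable (fun t : ℝ => ‖t‖ ^ (d + 2) * ‖w t‖) →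
      ∀ (x : TorusSite d L) {Q : Op (TorusSite d L × κ) q}, IsSupportedOn Q (cellBall x R) →
      ‖(∫ t : ℝ, w t • heisenbergEvolution (∑ Z, Φ Z + (c : ℂ) • ∑ Z, V Z) t Q) -
          ∫ t : ℝ, w t • heisenbergEvolution (∑ Z, Φ Z) t Q‖ ≤
        |c| * ‖Q‖ * (M * ((∫ t : ℝ, ‖w t‖) + ∫ t : ℝ, ‖t‖ ^ (d + 2) * ‖w t‖)) := by
  obtain ⟨A, hA0, hA⟩ := exists_lightCone_comm_bound d κ q r₀ r R
  refine ⟨A * 2 ^ (d + 2), by positivity, ?_⟩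
  intro L _ Φ V hΦ hΦr hΦn hV hVr hVn c hc w hw hmom x Q hQ
  -- the two Hamiltonians
  set H₀ : Op (TorusSite d L × κ) q := ∑ Z, Φ Z with hH₀def
  set Hc : Op (TorusSite d L × κ) q := ∑ Z, Φ Z + (c : ℂ) • ∑ Z, V Z with hHcdef
  have hH₀ : H₀.IsHermitian := by
    rw [hH₀def, ← localHamiltonian_univ_eq_sum]; exact localHamiltonian_isHermitian hΦ univ
  have hV₁ : (∑ Z, V Z).IsHermitian := by
    rw [← localHamiltonian_univ_eq_sum]; exact localHamiltonian_isHermitian hV univ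
  have hHc : Hc.IsHermitian := hH₀.add (isHermitian_ofReal_smul hV₁ c)
  have hdiffH : H₀ - Hc = -((c : ℂ) • ∑ Z, V Z) := by rw [hHcdef]; abel
  -- the Duhamel bound at each time
  have hpt : ∀ t : ℝ, ‖heisenbergEvolution Hc t Q - heisenbergEvolution H₀ t Q‖ ≤
      |c| * ‖Q‖ * A * (|t| * (1 + |t|) ^ (d + 1)) := by
    intro t
    have hη : ∀ u : ℝ, |u| ≤ |t| →
        ‖heisenbergEvolution H₀ u (H₀ - Hc) * Q - Q * heisenbergEvolution H₀ u (H₀ - Hc)‖ ≤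
          |c| * ‖Q‖ * A * (1 + |t|) ^ (d + 1) := by
      intro u hu
      rw [hdiffH, norm_comm_heisenbergEvolution_eq_norm_comm_neg hH₀]
      have h1 : -((c : ℂ) • ∑ Z, V Z) * heisenbergEvolution H₀ (-u) Q -
          heisenbergEvolution H₀ (-u) Q * -((c : ℂ) • ∑ Z, V Z) =
          -((c : ℂ) • ((∑ Z, V Z) * heisenbergEvolution H₀ (-u) Q -
            heisenbergEvolution H₀ (-u) Q * ∑ Z, V Z)) := by
        rw [smul_sub, Matrix.neg_mul, Matrix.mul_neg, Matrix.smul_mul, Matrix.mul_smul]; abel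
      rw [h1, norm_neg, norm_smul, Complex.norm_real, Real.norm_eq_abs]
      have h2 := (norm_sum_commutator_le univ (fun Z => V Z) (heisenbergEvolution H₀ (-u) Q)).trans
        (hA hΦ hΦr hΦn hV hVr hVn x hQ (-u))
      rw [abs_neg] at h2
      calc |c| * ‖(∑ Z, V Z) * heisenbergEvolution H₀ (-u) Q - heisenbergEvolution H₀ (-u) Q * ∑ Z, V Z‖
          ≤ |c| * (‖Q‖ * (A * (1 + |u|) ^ (d + 1))) := mul_le_mul_of_nonneg_left h2 (abs_nonneg c)
        _ ≤ |c| * (‖Q‖ * (A * (1 + |t|) ^ (d + 1))) := by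
            refine mul_le_mul_of_nonneg_left (mul_le_mul_of_nonneg_left
              (mul_le_mul_of_nonneg_left (pow_le_pow_left₀ (by positivity) (by linarith) _) hA0)
              (norm_nonneg _)) (abs_nonneg c)
        _ = |c| * ‖Q‖ * A * (1 + |t|) ^ (d + 1) := by ring
    have h := norm_heisenbergEvolution_sub_heisenbergEvolution_le_of_le hH₀ hHc Q hη
    rw [norm_sub_rev] at h
    calc ‖heisenbergEvolution Hc t Q - heisenbergEvolution H₀ t Q‖
        ≤ |c| * ‖Q‖ * A * (1 + |t|) ^ (d + 1) * |t| := h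
      _ = |c| * ‖Q‖ * A * (|t| * (1 + |t|) ^ (d + 1)) := by ring
  -- integrate
  have hi1 := integrable_smul_heisenbergEvolution hHc hw Q
  have hi0 := integrable_smul_heisenbergEvolution hH₀ hw Q
  rw [← integral_sub hi1 hi0]
  set G : ℝ → ℝ := fun t => |c| * ‖Q‖ * (A * 2 ^ (d + 2)) * (‖w t‖ + ‖t‖ ^ (d + 2) * ‖w t‖) with hG
  have hGi : Integrable G := (hw.norm.add hmom).const_mul _
  have hbound : ∀ t : ℝ, ‖w t • heisenbergEvolution Hc t Q - w t • heisenbergEvolution H₀ t Q‖ ≤ G t := by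
    intro t
    rw [← smul_sub, norm_smul]
    have hm := abs_mul_one_add_abs_pow_le t d
    calc ‖w t‖ * ‖heisenbergEvolution Hc t Q - heisenbergEvolution H₀ t Q‖
        ≤ ‖w t‖ * (|c| * ‖Q‖ * A * (|t| * (1 + |t|) ^ (d + 1))) :=
          mul_le_mul_of_nonneg_left (hpt t) (norm_nonneg _)
      _ ≤ ‖w t‖ * (|c| * ‖Q‖ * A * (2 ^ (d + 2) * (1 + |t| ^ (d + 2)))) :=
          mul_le_mul_of_nonneg_left (mul_le_mul_of_nonneg_left hm (by positivity)) (norm_nonneg _)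
      _ = G t := by rw [hG]; simp only [Real.norm_eq_abs]; ring
  calc ‖∫ t : ℝ, (w t • heisenbergEvolution Hc t Q - w t • heisenbergEvolution H₀ t Q)‖
      ≤ ∫ t : ℝ, G t := norm_integral_le_of_norm_le hGi (Filter.Eventually.of_forall hbound)
    _ = |c| * ‖Q‖ * (A * 2 ^ (d + 2)) * ((∫ t : ℝ, ‖w t‖) + ∫ t : ℝ, ‖t‖ ^ (d + 2) * ‖w t‖) := by
        rw [hG, integral_const_mul, integral_add hw.norm hmom]
    _ = |c| * ‖Q‖ * ((A * 2 ^ (d + 2)) * ((∫ t : ℝ, ‖w t‖) + ∫ t : ℝ, ‖t‖ ^ (d + 2) * ‖w t‖)) := by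
        ring

end Main

end Literature.MathematicalPhysics.QuantumLattice
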